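import Summits.CriticalPhenomena.CardyFormulaZ2.Theses.CardyIKTransport

/-!
# Vocabulary of the crux `CardyIKTransport.CornerLineDescent` (stmt-CriticalPhenomena-10964) and of its
# line `symmetric-seed-second-order`

Definitions-only support file (plus the definitional `cornerLineDescent_iff` and the two numerical facts
`pIK_pos`, `pIK_le_one`), so that the line's REGISTERED STUBS — landed one by one as
`--supports stmt-CriticalPhenomena-10964` files `Theorems/CardyIKTransportCornerLineDescent<Stub>.lean` — and the
lead's checked skeleton (`Cruxes/CornerLineDescent/Lines/symmetric-seed-second-order.lean`, namespace
`…Cruxes.CornerLineDescent.SymmetricSeedSecondOrder`, not importable from `Theorems/`) speak about the SAME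
declarations.  Every definition below is byte-identical in body to the checked skeleton (crux-plan 2026-08-16,
`ledger skeleton check` OK; lead reshape cycle 1 added `CrossingEventLocalAt`); only the namespace differs
(`…Theorems.CornerLineDescent.SymmetricSeed`, to keep fully-qualified names distinct from the crux workfile).
Nothing is asserted here: every `def … : Prop` is a statement the ROUTE POSITS (a registered stub quantifies
it) or a parametrised predicate; they are the line's sub-goals, not literature facts, and are never to be
relocated.

THE MODEL (the crux's own explicit i.i.d.-bit gauge, abstracted in the syndrome density `p`).  Bits
`ω = (A, B, D, D', C)`: column bits `A : Set ℤ`, row bits `B : Set ℤ`, syndromes (plaquette defects)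
`D : Set (Site 2)` of density `p`, an unused fair field `D'` (the `S = univ` specialisation of stmt-5911), fair
saddle coins `C`.  Colour of the cell `v`: `A_{v0} ⊕ B_{v1} ⊕ parity(D ∩ Rect(0,v))`; black graph = same-colour
axis neighbours + the coin-chosen diagonal of each face; cells embedded at `v0 + i v1`; crude crossing event
`embDomainCrossing` of a conformal rectangle at mesh `δ`.  `p = p_IK = 2√3 − 3` is the crux's `P_IK`
(`cornerLineDescent_iff`, `Iff.rfl`), `p = 0` is bond-ℤ² at `½` on the renewal grid.  THE STUB PREDICATES:
`SyndromeBiasAt` (conditional bias of one syndrome given a ring of colours), `InfluenceBoundOn` (second-order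
summed influence in units of `ξ_p`, the load-bearing claim), `DiluteBoundOn` (the frozen end), `RussoLipschitzOn`
(Margulis–Russo in mean-value form), `CrossingEventLocalAt` (finitely many relevant bits).

References: the route file `Theses/CardyIKTransport.lean` (item 10964); the line card
`Cruxes/CornerLineDescent/Lines/symmetric-seed-second-order.md`; `Cruxes/CornerLineDescent/Disproof.lean` §A–§H;
Beffara, arXiv:0708.3908 §5.2; Nolin, arXiv:0711.4948 §8.1; Garban–Pete–Schramm, arXiv:1008.1378 Prop. 11.
-/

noncomputable section

namespace Summit.CriticalPhenomena.CardyFormulaZ2.Theorems.CornerLineDescent.SymmetricSeed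

open scoped BigOperators Topology Classical MeasureTheory ProbabilityTheory ENNReal NNReal
open Filter Set Function MeasureTheory
open Literature.Probability.Percolation (sitePercolation bondPercolation half BondConfig embDomainCrossing rectangle)
open Literature.Probability.LatticeModels
open Literature.Probability.RandomPlanarGeometry

/-! ## §1 The corner-line gauge, abstracted in the defect density `p` -/

/-- The bit space of the crux's explicit gauge: column bits `A`, row bits `B`, plaquette defects
(syndromes) `D`, an unused fair defect field (the `S = univ` specialisation of stmt-5911), saddle coins. [folklore] -/
abbrev Bits : Type := Set ℤ × (Set ℤ × (Set (Site 2) × (Set (Site 2) × Set (Site 2))))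

/-- The corner-line product measure with syndrome density `p` (clamped to `[0,1]`): verbatim the crux's `μ`
with `2√3 − 3` replaced by `p`.  `p = 2√3−3` is the isotropic Izergin–Korepin point (`t = √3/2`), `p = 0`
the renewal-grid bond model, `p = ½` the i.i.d. colouring. [folklore] -/
def gaugeMeasure (p : ℝ) : Measure Bits :=
  (sitePercolation ℤ half).prod ((sitePercolation ℤ half).prod
    ((sitePercolation (Site 2) (Set.projIcc (0:ℝ) 1 zero_le_one p)).prod
      ((sitePercolation (Site 2) half).prod (sitePercolation (Site 2) half))))

/-- Colour of the cell `v`: `A_{v0} ⊕ B_{v1} ⊕` parity of the syndromes in the rectangle between `0` and `v`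
(verbatim the crux's `blk`, with its `par` at `S = univ`). [folklore] -/
def gaugeColour : Bits → Site 2 → Prop :=
  let par : Bits → Site 2 → Prop := fun ω f =>
    (f 0 ∈ (Set.univ : Set ℤ) ∧ f ∈ ω.2.2.1) ∨ (f 0 ∉ (Set.univ : Set ℤ) ∧ f ∈ ω.2.2.2.1)
  fun ω v => Xor (v 0 ∈ ω.1) (Xor (v 1 ∈ ω.2.1)
    (Odd ((Finset.filter (fun f : ℤ × ℤ => par ω ![f.1, f.2])
      (Finset.Ico (min 0 (v 0)) (max 0 (v 0)) ×ˢ Finset.Ico (min 0 (v 1)) (max 0 (v 1)))).card)))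

/-- The saddle coin at the face `f` (anti-diagonal chosen); verbatim the crux's `anti` at `S = univ`. [folklore] -/
def gaugeCoin : Bits → Site 2 → Prop := fun ω f => f 0 ∉ (Set.univ : Set ℤ) ∨ f ∈ ω.2.2.2.2

/-- The black bond configuration of the cell graph: same-colour axis neighbours, plus the coin-chosen
diagonal of each face (verbatim the crux's `edges`). [folklore] -/
def gaugeEdges (ω : Bits) : BondConfig (Site 2) :=
  {e | ∃ u v, e = s(u, v) ∧ gaugeColour ω u ∧ gaugeColour ω v ∧
    (v = u + ![1, 0] ∨ v = u + ![0, 1] ∨ (v = u + ![1, 1] ∧ ¬ gaugeCoin ω u) ∨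
      (v = u + ![1, -1] ∧ gaugeCoin ω (u + ![0, -1])))}

/-- The crude embedded crossing event of the conformal rectangle `R` at mesh `δ` (cells at `v0 + i v1`,
G02/GM14 recipe `embDomainCrossing`, arcs `0 → 2`), as an event on the bit space. [folklore] -/
def crossingEvent (R : ConformalRectangle) (δ : ℝ) : Set Bits :=
  {ω | gaugeEdges ω ∈ embDomainCrossing
    (fun v : Site 2 => ((v 0 : ℝ) : ℂ) + ((v 1 : ℝ) : ℂ) * Complex.I) R.carrier δ (R.arc 0) (R.arc 2)}

/-- Crude crossing probability of `R` at mesh `δ` for the corner-line model with syndrome density `p`.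
`gaugeCrossingProb (2√3−3)` is the crux's `P_IK` (`cornerLineDescent_iff`, `Iff.rfl`). [folklore] -/
def gaugeCrossingProb (p : ℝ) (R : ConformalRectangle) (δ : ℝ) : ℝ :=
  (gaugeMeasure p).real (crossingEvent R δ)

/-- The standard-embedding bond-`ℤ²` crude crossing probability at `p = ½` (the crux's consequent family,
verbatim). [folklore] -/
def bondStdCrossingProb (R : ConformalRectangle) (δ : ℝ) : ℝ :=
  (bondPercolation (zdGraph 2) half).real
    (embDomainCrossing squareLatticeEmbedding.z R.carrier δ (R.arc 0) (R.arc 2))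

/-- The isotropic Izergin–Korepin syndrome density `p_IK = 2√3 − 3 ≈ 0.4641` (`t = p/(1−p) = √3/2`). [folklore] -/
def pIK : ℝ := 2 * Real.sqrt 3 - 3

/-- `0 < p_IK` (`√3 > 3/2`). [folklore] -/
theorem pIK_pos : 0 < pIK := by
  have h : (3 / 2 : ℝ) < Real.sqrt 3 := (Real.lt_sqrt (by norm_num)).2 (by norm_num)
  unfold pIK; linarith

/-- `p_IK ≤ 1` (`√3 ≤ 2`). [folklore] -/
theorem pIK_le_one : pIK ≤ 1 := by
  have h3 : Real.sqrt 3 ^ 2 = 3 := Real.sq_sqrt (by norm_num)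
  have h0 : 0 ≤ Real.sqrt 3 := Real.sqrt_nonneg 3
  unfold pIK; nlinarith

/-- SANITY (`Iff.rfl`): the crux BY NAME is literally "Cardy for `gaugeCrossingProb p_IK` in every conformal
rectangle ⇒ Cardy for `bondStdCrossingProb` in every conformal rectangle". [folklore] -/
theorem cornerLineDescent_iff :
    Summit.CriticalPhenomena.CardyFormulaZ2.Theses.CardyIKTransport.CornerLineDescent ↔
      ((∀ R : ConformalRectangle, R.HasCrossingLimit (gaugeCrossingProb pIK R) cardyFunction) →
        ∀ R : ConformalRectangle, R.HasCrossingLimit (bondStdCrossingProb R) cardyFunction) :=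
  Iff.rfl

/-! ## §2 Russo's seed: the forced syndrome and its signed influence -/

/-- Force the syndrome bit at the face `f` to the value `b`, leaving every other bit unchanged. [folklore] -/
def force (f : Site 2) (b : Bool) (ω : Bits) : Bits :=
  (ω.1, ω.2.1, (if b then insert f ω.2.2.1 else ω.2.2.1 \ {f}), ω.2.2.2)

/-- The SIGNED INFLUENCE of the syndrome at `f` on the crude crossing of `R` at mesh `δ`, density `p`:
`I_f(p) = P_p[A | κ_f = 1] − P_p[A | κ_f = 0]` written through forced configurations (product measure:
forcing = conditioning).  By law-locality (`Negative.QuadrantFlipLocal`) `I_f = Cov_p(1_A, κ_f)/(p(1−p))`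
for `0 < p < 1`, the covariance of the crossing with the LOCAL face parity under `M(t,½)`, `t = p/(1−p)`;
faces whose defect rectangle misses the lattice window of `R` have `I_f = 0` exactly. [folklore] -/
def influence (p : ℝ) (R : ConformalRectangle) (δ : ℝ) (f : Site 2) : ℝ :=
  (gaugeMeasure p).real (force f true ⁻¹' crossingEvent R δ) -
    (gaugeMeasure p).real (force f false ⁻¹' crossingEvent R δ)

/-- The UNSIGNED Russo sum `Σ_f |I_f(p)|` over all faces (a `finsum`: only the finitely many faces in the
bounding box of the lattice window of `R` and the origin have non-zero influence; see `stub_Russo`). [folklore] -/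
def influenceSum (p : ℝ) (R : ConformalRectangle) (δ : ℝ) : ℝ :=
  ∑ᶠ f : Site 2, |influence p R δ f|

/-! ## §3 The statements of the line (parametrised predicates; quantified in the stub signatures) -/

/-- The boundary RING of the `(2r+2) × (2r+2)` block of cells centred on the face `f` (the face `f` is the
grid vertex shared by the cells `f, f+e₀, f+e₁, f+e₀+e₁`; the block is `[f0−r, f0+1+r] × [f1−r, f1+1+r]`). [folklore] -/
def faceRing (f : Site 2) (r : ℕ) : Set (Site 2) :=
  {v | (f 0 - r ≤ v 0 ∧ v 0 ≤ f 0 + 1 + r ∧ f 1 - r ≤ v 1 ∧ v 1 ≤ f 1 + 1 + r) ∧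
    (v 0 = f 0 - r ∨ v 0 = f 0 + 1 + r ∨ v 1 = f 1 - r ∨ v 1 = f 1 + 1 + r)}

/-- The cylinder event "the colours on the ring `faceRing f r` are given by `η`". [folklore] -/
def ringCylinder (f : Site 2) (r : ℕ) (η : Site 2 → Prop) : Set Bits :=
  {ω | ∀ v ∈ faceRing f r, (gaugeColour ω v ↔ η v)}

/-- `SyndromeBiasAt p C`: under the gauge with density `p`, for every radius `r ≥ 1`, every face `f` and
every ring colouring `η`, the conditional bias of the syndrome at `f` given the ring colours is at most
`C ρ^{2r}`, `ρ = |1 − 2p|` — stated multiplicatively (no division by the cylinder probability):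
`|P[κ_f = 1, Cyl] − p·P[Cyl]| ≤ C ρ^{2r} P[Cyl]`.  WHY TRUE: the block marginal of the gauge is the free
corner-fugacity field (uniform antiderivative: `σ = a_x ⊕ b_y ⊕ Π_block`), the ring colours reveal exactly
`a ⊕ b` and the full-row / full-column parities of the `(2r+1)²` enclosed i.i.d. Bernoulli(`p`) syndromes,
and by the character expansion over the row/column code (all non-zero codewords have weight `≥ 2r+1`; only
codewords through `f` contribute to the bias, the lightest being the row and the column of `f`)
`E[(−1)^{κ_f} | parities] − ρ = ±(1−ρ²)·2ρ^{2r}(1 + O_ρ(1))/D(s)` with `D(s) → 1`; exact enumeration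
(triage r1-3, E1, 4×4 block = `r = 1`): max bias `5.9e-3` at `t = √3/2` (`ρ² = 5.2e-3`), `0` at `t = 1`.
By the Markov property of the plaquette weight across a width-one ring and the independence of the coins,
this is the conditional bias given EVERYTHING outside the core block — the `m_f` of the zero-amplitude
argument. [folklore] -/
def SyndromeBiasAt (p C : ℝ) : Prop :=
  ∀ r : ℕ, 1 ≤ r → ∀ (f : Site 2) (η : Site 2 → Prop),
    |(gaugeMeasure p).real ({ω | f ∈ ω.2.2.1} ∩ ringCylinder f r η) -
        p * (gaugeMeasure p).real (ringCylinder f r η)| ≤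
      C * |1 - 2 * p| ^ (2 * r) * (gaugeMeasure p).real (ringCylinder f r η)

/-- `InfluenceBoundOn R θ C c₀ δ`: at mesh `δ`, for every density `p` with `c₀ δ ≤ p ≤ p_IK` (box larger
than `c₀⁻¹` wall-persistence lengths `ξ_p ≍ 1/p`), the unsigned Russo sum is second order:
`Σ_f |I_f(p)| ≤ C p⁻¹ (δ/p)^θ`, i.e. `Σ_f |Cov_p(1_A, κ_f)| ≤ C (1−p) (δ/p)^θ` — so
`|p ∂_p P_p(A)| ≤ C (δ/p)^θ = C (δ ξ_p)^θ`: the log-derivative along the corner line is small as soon as the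
wall-persistence length `δ ξ_p` (macroscopic units) is small.  THE LOAD-BEARING CLAIM OF THE LINE (card U2;
`CoveringLatticeShiftNarrow`'s un-blocked residue (b), a RATE): per bulk face, a gain of `δ^{3/4+θ}` over
the four-arm price `π₄ ≈ δ^{5/4}` needs the zero four-arm amplitude of the symmetric seed (`ι`-oddness +
`SyndromeBiasAt`) AND a memory rate `> 3/4 = 2 − α₄` in the `ι`-odd, `D₄`-trivial sector (bet: six-arm
minus four-arm, `35/12 − 5/4 > 3/4`); the boundary layer
(response exponent `1`, `δ⁻¹` faces; Disproof §G(4)) and exterior faces (those recolouring the window by a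
half-plane: zero exactly, half-plane flips being gauge symmetries, cf. `Negative.isOddFace_halfFlip₀_iff`; those
whose two rays cut the window: exterior dislocations, parity correlations `ρ^{area}`) are INCLUDED in the sum
and must be budgeted separately by the prover. [folklore] -/
def InfluenceBoundOn (R : ConformalRectangle) (θ C c₀ δ : ℝ) : Prop :=
  ∀ p : ℝ, c₀ * δ ≤ p → p ≤ pIK → influenceSum p R δ ≤ C * p⁻¹ * (δ / p) ^ θ

/-- `DiluteBoundOn R c C κ δ`: in the dilute regime `0 ≤ p ≤ c δ` (`O(c)` dislocations per grid line, wall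
persistence `ξ_p ≥ (cδ)⁻¹` macroscopic) the unsigned Russo sum is `≤ C δ^{κ−1}`, i.e. the signed annealed
single-dislocation influence has size exponent `x₀ = 1 + κ > 1` uniformly over faces (`Σ_f` has `≍ δ⁻²`
terms).  WHY PLAUSIBLE: law-locality puts the natural size at the core four-arm price `x₀ = x₄ = 5/4`
(Disproof §G(2)); the unsigned seam coupling only gives `x₀ = 1/4`, so the proof is the SIGNED lemma —
annealed Burgers neutrality (face types `∅, V, H, +` each of probability exactly `1/4`, `b_∅ = −b_+`,
`b_V = −b_H`, triage r1-2 S2) kills the `O(δ)` strain term, the frozen-end face of the `D₄` selection rule;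
numerics: exact `4×2, 6×3` anchors `−0.0547, −0.0319` and paired MC `L = 8…128` give `|I_f| ≈ n^{−1.2}`,
same sign (triage r1-3 T1; kit j010398, j010196/j010258, j010369 pending).  This is the honest second hard
stub (triage r1-1 (3)): RegimeOne is NOT bond-`ℤ²` toolbox. [folklore] -/
def DiluteBoundOn (R : ConformalRectangle) (c C κ δ : ℝ) : Prop :=
  ∀ p : ℝ, 0 ≤ p → p ≤ c * δ → influenceSum p R δ ≤ C * δ ^ (κ - 1)

/-- `RussoLipschitzOn R δ p₁ p₂ M`: the Margulis–Russo formula for the NON-MONOTONE product gauge in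
mean-value form — if `Σ_f |I_f(p)| ≤ M` on `[p₁, p₂]` then `|P_{p₂}(A) − P_{p₁}(A)| ≤ M (p₂ − p₁)`.
WHY TRUE / WORK: the crude event depends on the bits of finitely many cells (the lattice window of the
bounded `R.carrier`), hence on finitely many syndromes (those in the bounding box of the window and the
origin — every other face has `force f b ⁻¹' A = A`, so `I_f = 0` and the `finsum` is a finite sum), so
`p ↦ P_p(A)` is a polynomial on `[0,1]` with derivative `Σ_f I_f(p)` (`Set.projIcc` is the identity there);
then the mean value inequality.  Lean work: cylinder-set measurability and independence for
`sitePercolation = setBer(univ, p)`, product-measure Fubini. [folklore] -/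
def RussoLipschitzOn (R : ConformalRectangle) (δ p₁ p₂ M : ℝ) : Prop :=
  (∀ p : ℝ, p₁ ≤ p → p ≤ p₂ → influenceSum p R δ ≤ M) →
    |gaugeCrossingProb p₂ R δ - gaugeCrossingProb p₁ R δ| ≤ M * (p₂ - p₁)

/-- `CrossingEventLocalAt R δ`: the crude crossing event of `R` at mesh `δ` is DETERMINED BY FINITELY MANY BITS of
each of the five factors (column bits, row bits, syndromes, the unused field, coins): two bit configurations that
agree on the finite sets `K₁, …, K₅` are both in or both out of `crossingEvent R δ`.  WHY TRUE (for `δ > 0`): the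
window `W = {v | δ·(v0 + i v1) ∈ R.carrier}` is finite (`R.carrier` is bounded), an open path of the event has all
its vertices in `W` (`embDomainCrossing = openCrossing W _ _`, `PlanarDuality.determinedBy_openCrossing`), an edge
`s(u,v)` with `u, v ∈ W` is in `gaugeEdges ω` iff a condition on the colours of `u, v` and the coins at `u`,
`u + (0,-1)` holds, and `gaugeColour ω v` reads `ω.1` at `v0`, `ω.2.1` at `v1` and `ω.2.2.1` on the finite rectangle
`Ico (min 0 v0) (max 0 v0) × Ico (min 0 v1) (max 0 v1)` (the fourth factor is never read: `par` at `S = univ`).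
The finite-support property of `influenceSum` (faces outside `K₃` have `force f b ⁻¹' A = A`, influence `0`) and the
measurability of the event (finite union of product cylinders) both follow. [folklore] -/
def CrossingEventLocalAt (R : ConformalRectangle) (δ : ℝ) : Prop :=
  ∃ (K₁ K₂ : Finset ℤ) (K₃ K₄ K₅ : Finset (Site 2)), ∀ ω ω' : Bits,
    ω.1 ∩ ↑K₁ = ω'.1 ∩ ↑K₁ → ω.2.1 ∩ ↑K₂ = ω'.2.1 ∩ ↑K₂ → ω.2.2.1 ∩ ↑K₃ = ω'.2.2.1 ∩ ↑K₃ →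
      ω.2.2.2.1 ∩ ↑K₄ = ω'.2.2.2.1 ∩ ↑K₄ → ω.2.2.2.2 ∩ ↑K₅ = ω'.2.2.2.2 ∩ ↑K₅ →
        (ω ∈ crossingEvent R δ ↔ ω' ∈ crossingEvent R δ)

end Summit.CriticalPhenomena.CardyFormulaZ2.Theorems.CornerLineDescent.SymmetricSeed
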